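import Summits.BirchSwinnertonDyer.BirchSwinnertonDyer.Theorems.GenusKolyvaginAtTwoPowDvdShaCardAtTwoRTTransverseIsotropic
import HarnessLib

/-!
# Route `GenusKolyvaginAtTwo`, crux L_T `PowDvdShaCardAtTwoRT` (stmt-BirchSwinnertonDyer-23242), LINE 18 stub L, bottom rung
# (index-`≥ 2` engine, deep own primes): THE DOUBLED LOCAL CUP PRODUCT OF TWO HALF-TRANSVERSE CLASSES VANISHES

Seat `bsd-line-gk2-p3` g21 (PROVER seat 3/3, cell `bsd-f1-sign2`), `--supports 23242 --as helper`.  THEOREMS ONLY (no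
definition, no named fact, no `sorry`).  Sequel to this lineage's `…RTTransverseIsotropic` (g19, I7 at `2` over `ℚ_ℓ`).  BSD is
NOT proved by any of this; neither is the crux nor stub L.

WHY (LEAD memo `Cruxes/PowDvdShaCardAtTwoRT/Lines/plus-descent-lead-g16.md` §2 and §8).  In the bottom-rung engine for index-`≥ 2`
witnesses the reciprocity law is applied to `X := 2·Z` (`Z = desc c₂(nℓ′) ∈ H¹(ℚ, E^ε[4])`) against an auxiliary `y`; at a DEEP own
prime `ℓ ∈ t` neither class is transverse — `Z_ℓ` and `y_ℓ` lie in the index-`2` subgroup `M_ℓ = H¹_tr ⊕ H¹_f[2]` («`2•z` is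
transverse», equivalently «the value `[z, F]` at the Frobenius lies in `(F − 1)T + 2T`»: HALF-TRANSVERSE) — and the LEAD's §8
observes that then `⟨X_ℓ, y_ℓ⟩ = 2⟨Z_ℓ, y_ℓ⟩ = 0` «by bilinearity alone».  This file proves that statement in the `h1Eval` /
`weilContPairing` currency of I7, at the COCHAIN level and for every level `q = p^M`: if `[x, F], [y, F] ∈ (F − 1)T + p·T` then
EVERY value of the chosen cocycles of `x`, `y` on the decomposition group lies in `(F − 1)T + p·T` (§2; tame values and the values at
the powers of `F` are handled as in I7), and `p^{M−1}·e(l + pQ, l′ + pQ′) = p^{M−1} e(l, l′) = 0` because the anti-invariant line is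
isotropic (I7 §1) and `e` is killed by `q` (§1); so the `2`-cochain of `p^{M−1}·(loc x ∪ loc y)` vanishes identically (§0, §3).
At `p = 2`, `M = 2` this is `2·(loc_ℓ Z ∪ loc_ℓ y) = loc_ℓ (2Z) ∪ loc_ℓ y = 0` — the deep-own-prime term of the engine — with NO
appeal to the splitting `H¹ = H¹_f ⊕ H¹_tr`, to Tate's self-orthogonality of `H¹_f`, or to a Hilbert symbol.

* §0 `nsmul_cupClass_eq_zero_of_nsmul_toLin_apply_eq_zero` — `m·[f ∪ g] = 0` when `m·⟨f a, g b⟩ = 0` for all values.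
* §1 `nsmul_pairing_eq_zero_of_line_add` — `p^{M−1}·e(v, v′) = 0` for `v, v′ ∈ T^{F=−1} + p·T` (regular `F`, `e` alternating, `q·e = 0`).
* §2 `exists_h1Eval_resGal_eq_line_add_of_halfTransverse` — values of a half-transverse class on `Γ_{ℚ_ℓ}` lie in `T^{F=−1} + p·T`.
* §3 **`nsmul_cupProduct_localization_eq_zero_of_halfTransverse`** — `p^{M−1}·(loc_v x ∪ₑ loc_v y) = 0`; and
  `cupProduct_localization_nsmul_eq_zero_of_halfTransverse` — `loc_v (p^{M−1}·x) ∪ₑ loc_v y = 0`.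
* (sequel `…RTHalfTransverseIsotropicPackaged`: the packaged forms on `Δ(E) < 0` at a Gross–Kolyvagin prime of depth `M` for
  `p = 2`, the `inv`-form, and the bridges recognising half-transversality.)
HONEST FRAMING: helper; which classes the engine feeds in (`Z = desc c₂(nℓ′)`, the auxiliary `y`) and the COUNT of the half-transverse
condition (`#M_ℓ = 8`: this seat's `…RTDoublingIsotropy` / `…RTOrderFourAuxiliaryGeneral`) are elsewhere.  BSD is NOT proved by any of this.

References: [McCallumLMS1991] §4 Prop. 4.4, §5 Lemma 5.3 and proof of Prop. 5.2 (p. 309); [GrossLMS1991] §3 (3.2)–(3.3), §7 (7.2);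
[NeukirchSchmidtWingberg2008] I §4.
-/

set_option autoImplicit false
set_option linter.dupNamespace false -- tree convention: `Summit.BirchSwinnertonDyer.BirchSwinnertonDyer.Theorems` (summit = sub-problem)

noncomputable section
open scoped Classical Pointwise
universe u v

namespace Summit.BirchSwinnertonDyer.BirchSwinnertonDyer.Theorems.GenusExact.TransverseIsotropy

open WeierstrassCurve NumberField IsDedekindDomain Field
open Literature.NumberTheory.EllipticCurves Literature.NumberTheory.GaloisRepresentations
open Literature.NumberTheory.GaloisCohomology
open Summit.BirchSwinnertonDyer.BirchSwinnertonDyer.Theorems.GenusExact.FrobeniusCriterion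

/-! ## §0 A multiple of a cup product vanishes when that multiple kills the pairing of values -/

section Cochain

variable {R : Type u} [CommRing R] [TopologicalSpace R] {G : Type v} [Group G] [TopologicalSpace G]
  [IsTopologicalGroup G] [LocallyCompactSpace G] {X Y Z : TopRep.{v} R G} (φ : ContPairing X Y Z)
  (f : contOneCocycles X) (g : contOneCocycles Y)

/-- **`m·[f ∪ g] = 0` when `m·⟨f a, g b⟩ = 0` for all values** of the two crossed homomorphisms: `m·[f ∪ g] = [f ∪ (m·g)]` and the
`2`-cochain of `f ∪ (m·g)`, `(a,b,c) ↦ ⟨f b − f a, m(g c − g b)⟩ = m⟨f b − f a, g c − g b⟩`, vanishes identically. [folklore] -/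
theorem nsmul_cupClass_eq_zero_of_nsmul_toLin_apply_eq_zero (m : ℕ) (h : ∀ a b : G, m • φ.toLin (f.1 a) (g.1 b) = 0) :
    m • φ.cupClass f g = 0 := by
  rw [← Nat.cast_smul_eq_nsmul R, ← ContPairing.cupClass_smul_right]
  refine cupClass_eq_zero_of_toLin_apply_eq_zero φ f ((m : R) • g) fun a b ↦ ?_
  have hg : ((m : R) • g).1 b = (m : R) • g.1 b := by
    rw [Submodule.coe_smul, ContinuousMap.smul_apply]
  rw [hg, LinearMap.map_smul, Nat.cast_smul_eq_nsmul]
  exact h a b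

/-- The same on classes: **`m·([f] ∪ [g]) = 0`** when `m·⟨f a, g b⟩ = 0` for all values. [folklore] -/
theorem nsmul_cupProduct_oneCocycleClass_eq_zero_of_nsmul_toLin_apply_eq_zero (m : ℕ)
    (h : ∀ a b : G, m • φ.toLin (f.1 a) (g.1 b) = 0) :
    m • φ.cupProduct (oneCocycleClass X f) (oneCocycleClass Y g) = 0 := by
  rw [ContPairing.cupProduct_oneCocycleClass]
  exact nsmul_cupClass_eq_zero_of_nsmul_toLin_apply_eq_zero φ f g m h

end Cochain

/-! ## §0b `μ_q` is killed by `q` -/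

/-- Every element of `μ_q` (additively: `MuCarrier F q`) is killed by `q`. [folklore] -/
theorem nsmul_muCarrier_eq_zero {L : Type u} [Field L] (q : ℕ) (c : DiscreteGaloisModule.MuCarrier L q) : q • c = 0 := by
  rw [muCarrier_eq_iff, map_nsmul, toMul_nsmul, map_zero, toMul_zero, SubmonoidClass.coe_pow, Units.val_pow_eq_pow_val,
    OneMemClass.coe_one, Units.val_one]
  have h := ((DiscreteGaloisModule.MuCarrier.toAdditive c).toMul).2
  rw [mem_rootsOfUnity] at h
  rw [← Units.val_pow_eq_pow_val, h, Units.val_one]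

/-! ## §1 `p^{M−1}` kills the pairing on `T^{F=−1} + p·T` -/

section Algebra

variable {K : Type u} [Field K] (W : WeierstrassCurve K) {n : ℤ} {F : absoluteGaloisGroup K} {q : ℤ}
  {P : geomTorsion W n}

/-- **`m·e(v, v′) = 0` for `v, v′ ∈ T^{F=−1} + p·T` when `m·p` kills `e`**: for `T = E[n]` free of rank one over `ℤ/q[F]` on `P`
(`F` an involution), `e` biadditive alternating with values in a group killed by `m·p` (e.g. `q = p^M`, `m = p^{M−1}`, `μ_q`), and
`v = l + pQ`, `v′ = l′ + pQ′` with `Fl = −l`, `Fl′ = −l′`: `m·e(v,v′) = m·e(l,l′) + (mp)·(…) = 0`, since the anti-invariant line is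
isotropic (`pairing_eq_zero_of_smul_eq_neg`). [cite: McCallumLMS1991, §5 Lemma 5.3 and proof of Prop. 5.2] -/
theorem nsmul_pairing_eq_zero_of_line_add (hF : ∀ Q : geomTorsion W n, F • F • Q = Q) (hPq : q • P = 0)
    (hgen : ∀ Q : geomTorsion W n, ∃ x y : ℤ, Q = x • P + y • F • P)
    (hfree : ∀ x y : ℤ, x • P + y • F • P = 0 → q ∣ x ∧ q ∣ y)
    {C : Type*} [AddCommGroup C] (e : geomTorsion W n →+ geomTorsion W n →+ C) (halt : ∀ a, e a a = 0)
    (m p : ℕ) (hC : ∀ c : C, (m * p) • c = 0)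
    {v v' : geomTorsion W n} (hv : ∃ l Q : geomTorsion W n, F • l = -l ∧ v = l + p • Q)
    (hv' : ∃ l' Q' : geomTorsion W n, F • l' = -l' ∧ v' = l' + p • Q') : m • e v v' = 0 := by
  obtain ⟨l, Q, hl, rfl⟩ := hv
  obtain ⟨l', Q', hl', rfl⟩ := hv'
  have hll' : e l l' = 0 := pairing_eq_zero_of_smul_eq_neg W hF hPq hgen hfree e halt hl hl'
  have hexp : e (l + p • Q) (l' + p • Q') = e l l' + p • (e l Q' + e Q l' + p • e Q Q') := by
    simp only [map_add, map_nsmul, AddMonoidHom.add_apply, AddMonoidHom.nsmul_apply, smul_add]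
    abel
  rw [hexp, hll', zero_add, smul_smul, hC]

/-- `T^{F=−1} + p·T` is closed under addition (witnesses add). [folklore] -/
theorem exists_line_add_of_add {p : ℕ} {v v' : geomTorsion W n}
    (hv : ∃ l Q : geomTorsion W n, F • l = -l ∧ v = l + p • Q)
    (hv' : ∃ l' Q' : geomTorsion W n, F • l' = -l' ∧ v' = l' + p • Q') :
    ∃ l'' Q'' : geomTorsion W n, F • l'' = -l'' ∧ v + v' = l'' + p • Q'' := by
  obtain ⟨l, Q, hl, rfl⟩ := hv
  obtain ⟨l', Q', hl', rfl⟩ := hv'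
  refine ⟨l + l', Q + Q', by rw [smul_add, hl, hl', neg_add], ?_⟩
  rw [smul_add]
  abel

/-- An anti-invariant element lies in `T^{F=−1} + p·T` (with `Q = 0`). [folklore] -/
theorem exists_line_add_of_smul_eq_neg {p : ℕ} {t : geomTorsion W n} (ht : F • t = -t) :
    ∃ l Q : geomTorsion W n, F • l = -l ∧ t = l + p • Q :=
  ⟨t, 0, ht, by rw [smul_zero, add_zero]⟩

/-- `F^k·a` is anti-invariant when `a` is (`F² = 1` on `T`, so `F^k` acts as `1` or `F`). [folklore] -/
theorem pow_smul_smul_eq_neg (hF : ∀ Q : geomTorsion W n, F • F • Q = Q) (k : ℕ) {a : geomTorsion W n}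
    (ha : F • a = -a) : F • (F ^ k • a) = -(F ^ k • a) := by
  rcases pow_smul_eq_or W hF k with hk | hk
  · rw [hk, ha]
  · rw [hk, hF, ha, neg_neg]

/-- **Values at the powers of `F` of a half-transverse class**: if `[x, F] = (FP₁ − P₁) + pQ₁` then for every `k`,
`[x, F^k] ∈ T^{F=−1} + p·T` (cocycle identity `[x, F^{k+1}] = [x, F^k] + F^k[x, F]`, and `F^k(FP₁ − P₁)` is anti-invariant).
[folklore] -/
theorem exists_h1Eval_pow_eq_line_add (hF : ∀ Q : geomTorsion W n, F • F • Q = Q) {p : ℕ} {x : galH1Torsion W n}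
    (hx : ∃ P₁ Q₁ : geomTorsion W n, h1Eval W n x F = (F • P₁ - P₁) + p • Q₁) (k : ℕ) :
    ∃ l Q : geomTorsion W n, F • l = -l ∧ h1Eval W n x (F ^ k) = l + p • Q := by
  obtain ⟨P₁, Q₁, hP₁⟩ := hx
  have ha : F • (F • P₁ - P₁) = -(F • P₁ - P₁) := by rw [smul_sub, hF, neg_sub]
  induction k with
  | zero => exact ⟨0, 0, by rw [smul_zero, neg_zero], by rw [pow_zero, h1Eval_one, smul_zero, add_zero]⟩
  | succ k ih =>
    obtain ⟨l, Q, hl, hk⟩ := ih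
    refine ⟨l + F ^ k • (F • P₁ - P₁), Q + F ^ k • Q₁, ?_, ?_⟩
    · rw [smul_add, hl, pow_smul_smul_eq_neg W hF k ha, neg_add]
    · rw [pow_succ, h1Eval_mul_smul, hk, hP₁, smul_add, smul_comm (F ^ k) p Q₁, smul_add]
      abel

end Algebra

/-! ## §2 Values of a half-transverse cocycle on the decomposition group -/

section Values

variable {v : HeightOneSpectrum (𝓞 ℚ)} (W : WeierstrassCurve ℚ) [W.IsElliptic]

/-- **Every value on the decomposition group of the chosen cocycle of a HALF-TRANSVERSE class lies in `T^{F=−1} + p·T`.**  Setting of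
`smul_h1Eval_resGal_eq_neg_of_transverse` (`q = p^M` prime to `v`; `𝔓 ∣ v` the prime of the chosen embedding; `F` an arithmetic
Frobenius at `𝔓` with `F² = 1` on `T = E[q]`, inverting `μ_q`; `I_𝔓` fixing `T`; `Γ_{ℚ(T)}` open).  If `[x, F] = (FP₁ − P₁) + pQ₁`
(`x` HALF-TRANSVERSE at `v`), then for every `g ∈ Γ_{ℚ_v}`, **`[x, res g] = l + pQ` with `Fl = −l`**: `res g = F^k·i·u`, cocycle
identity, §1 for `[x, F^k]`, and the anti-invariance of the tame value `[x, i]` (`smul_h1Eval_eq_neg_of_mem_inertia`).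
[cite: McCallumLMS1991, §4 Prop. 4.4 (3), §5 Lemma 5.3] [cite: GrossLMS1991, §3 (3.3)] -/
theorem exists_h1Eval_resGal_eq_line_add_of_halfTransverse {p M q : ℕ} (hp : p.Prime) (hq : q = p ^ M)
    (hqv : (q : 𝓞 ℚ) ∉ v.asIdeal)
    {𝔐 : Ideal (HeightOneSpectrum.localAbsIntegers v)} (h𝔐 : 𝔐 ∈ v.localPrimesAbove)
    {F : absoluteGaloisGroup ℚ}
    (hFrob : IsArithFrobAt (𝓞 ℚ) F (v.primeBelow (closureEmb (K := ℚ) (v.adicCompletion ℚ)) 𝔐))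
    (hFμ : ∀ ζ : AlgebraicClosure ℚ, ζ ^ q = 1 → F • ζ = ζ⁻¹)
    (hF : ∀ Q : geomTorsion W (q : ℤ), F • F • Q = Q)
    (hI : (v.primeBelow (closureEmb (K := ℚ) (v.adicCompletion ℚ)) 𝔐).inertia (absoluteGaloisGroup ℚ) ≤
      torsionFixing W (q : ℤ))
    (hopen : IsOpen (torsionFixing W (q : ℤ) : Set (absoluteGaloisGroup ℚ)))
    {x : galH1Torsion W (q : ℤ)}
    (hx : ∃ P₁ Q₁ : geomTorsion W (q : ℤ), h1Eval W (q : ℤ) x F = (F • P₁ - P₁) + p • Q₁)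
    (g : absoluteGaloisGroup (v.adicCompletion ℚ)) :
    ∃ l Q : geomTorsion W (q : ℤ), F • l = -l ∧
      h1Eval W (q : ℤ) x (resGal (K := ℚ) (v.adicCompletion ℚ) g) = l + p • Q := by
  set ι₀ := closureEmb (K := ℚ) (v.adicCompletion ℚ) with hι₀
  set 𝔓 := v.primeBelow ι₀ 𝔐 with h𝔓def
  have h𝔓 : 𝔓 ∈ v.primesAbove := HeightOneSpectrum.primeBelow_mem_primesAbove h𝔐
  haveI : 𝔓.IsPrime := h𝔓.1
  have hF𝔓 : F • 𝔓 = 𝔓 := MulAction.mem_stabilizer_iff.mp hFrob.mem_stabilizer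
  -- `res g ∈ G_𝔓 = ⟨F⟩ · I_𝔓 · U`, `U` the open kernel of `[x, ·]` inside `Γ_{ℚ(T)}`
  have hd : resGal (K := ℚ) (v.adicCompletion ℚ) g ∈ 𝔓.decompositionSubgroup (absoluteGaloisGroup ℚ) := by
    rw [resGal_eq]; exact resGalOfEmb_mem_decompositionSubgroup ι₀ h𝔐 g
  obtain ⟨k, i, w, hi, hw, hdec⟩ :=
    exists_eq_frobenius_pow_mul_of_mem_decompositionSubgroup h𝔓 hFrob
      (isOpen_evalKer W (q : ℤ) (fun _ : Unit ↦ x) hopen) hd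
  have hxw : h1Eval W (q : ℤ) x w = 0 := hw.2 ()
  -- the value at `res g`
  have hval : h1Eval W (q : ℤ) x (resGal (K := ℚ) (v.adicCompletion ℚ) g) =
      h1Eval W (q : ℤ) x (F ^ k) + F ^ k • h1Eval W (q : ℤ) x i := by
    rw [hdec, h1Eval_mul_smul, h1Eval_mul_smul, hxw, smul_zero, add_zero]
  -- the tame value is anti-invariant, hence so is `F^k` times it
  have ht : F • (F ^ k • h1Eval W (q : ℤ) x i) = -(F ^ k • h1Eval W (q : ℤ) x i) :=
    pow_smul_smul_eq_neg W hF k (smul_h1Eval_eq_neg_of_mem_inertia W hp hq hqv h𝔓 hF𝔓 hFμ hI x hi)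
  rw [hval]
  exact exists_line_add_of_add W (exists_h1Eval_pow_eq_line_add W hF hx k) (exists_line_add_of_smul_eq_neg W ht)

end Values

/-! ## §3 The multiple `p^{M−1}` of the local cup product of two half-transverse classes vanishes -/

section Main

variable {v : HeightOneSpectrum (𝓞 ℚ)} (W : WeierstrassCurve ℚ) [W.IsElliptic]

/-- **`p^{M−1}·(loc_v x ∪ₑ loc_v y) = 0` for two HALF-TRANSVERSE classes** (setting of `cupProduct_localization_eq_zero_of_transverse`:
`q = p^M`, `T = E[q]` free of rank one over `ℤ/q[F]` on `P`, `e` an alternating biadditive `Γ_ℚ`-equivariant `μ_q`-valued pairing).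
If `[x, F], [y, F] ∈ (F − 1)T + p·T`, then the restricted cocycles take values in `T^{F=−1} + p·T` (§2), on which `p^{M−1}·e`
vanishes (§1: the line is isotropic and `q·e = 0`), so the `2`-cochain of `p^{M−1}·(loc x ∪ loc y)` is identically zero (§0).  At
`p = 2`, `M = 2`: `2·(loc_ℓ Z ∪ loc_ℓ y) = 0` — the deep-own-prime term of LINE 18's index-`≥ 2` bottom-rung engine (LEAD memo §8,
«by bilinearity alone»). [cite: McCallumLMS1991, §5 Lemma 5.3 and proof of Prop. 5.2 (p. 309)] [cite: GrossLMS1991, §7 (7.2)] -/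
theorem nsmul_cupProduct_localization_eq_zero_of_halfTransverse {p M q : ℕ} [NeZero q] (hp : p.Prime) (hq : q = p ^ M)
    (hM : 1 ≤ M) (hqv : (q : 𝓞 ℚ) ∉ v.asIdeal)
    {𝔐 : Ideal (HeightOneSpectrum.localAbsIntegers v)} (h𝔐 : 𝔐 ∈ v.localPrimesAbove)
    {F : absoluteGaloisGroup ℚ}
    (hFrob : IsArithFrobAt (𝓞 ℚ) F (v.primeBelow (closureEmb (K := ℚ) (v.adicCompletion ℚ)) 𝔐))
    (hFμ : ∀ ζ : AlgebraicClosure ℚ, ζ ^ q = 1 → F • ζ = ζ⁻¹)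
    (hF : ∀ Q : geomTorsion W (q : ℤ), F • F • Q = Q)
    {P : geomTorsion W (q : ℤ)} (hPq : (q : ℤ) • P = 0)
    (hgen : ∀ Q : geomTorsion W (q : ℤ), ∃ x y : ℤ, Q = x • P + y • F • P)
    (hfree : ∀ x y : ℤ, x • P + y • F • P = 0 → (q : ℤ) ∣ x ∧ (q : ℤ) ∣ y)
    (hI : (v.primeBelow (closureEmb (K := ℚ) (v.adicCompletion ℚ)) 𝔐).inertia (absoluteGaloisGroup ℚ) ≤
      torsionFixing W (q : ℤ))
    (hopen : IsOpen (torsionFixing W (q : ℤ) : Set (absoluteGaloisGroup ℚ)))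
    (e : geomTorsion W q → geomTorsion W q → AlgebraicClosure ℚ)
    (hμ : ∀ S T, e S T ^ q = 1) (hadd₁ : ∀ S₁ S₂ T, e (S₁ + S₂) T = e S₁ T * e S₂ T)
    (hadd₂ : ∀ S T₁ T₂, e S (T₁ + T₂) = e S T₁ * e S T₂) (halt : ∀ T, e T T = 1)
    (hgal : ∀ (σ : absoluteGaloisGroup ℚ) (S T : geomTorsion W q), σ • e S T = e (σ • S) (σ • T))
    {x y : galH1Torsion W (q : ℤ)}
    (hx : ∃ P₁ Q₁ : geomTorsion W (q : ℤ), h1Eval W (q : ℤ) x F = (F • P₁ - P₁) + p • Q₁)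
    (hy : ∃ P₂ Q₂ : geomTorsion W (q : ℤ), h1Eval W (q : ℤ) y F = (F • P₂ - P₂) + p • Q₂) :
    haveI := absoluteGaloisGroup_compactSpace (v.adicCompletion ℚ)
    p ^ (M - 1) • ((weilContPairing W q e hμ hadd₁ hadd₂ hgal).restrict
      (absGaloisRestrict ℚ (v.adicCompletion ℚ))).cupProduct
        (galoisCohomology.localization (W.torsionGaloisModule ((q : ℕ) : ℤ)) (Sum.inr v) 1 x)
        (galoisCohomology.localization (W.torsionGaloisModule ((q : ℕ) : ℤ)) (Sum.inr v) 1 y) = 0 := by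
  haveI := absoluteGaloisGroup_compactSpace (v.adicCompletion ℚ)
  -- the localisations are the classes of the restricted chosen cocycles
  have hx' := galoisCohomology.res_oneCocycleClass (W.torsionGaloisModule ((q : ℕ) : ℤ)) (v.adicCompletion ℚ)
    (reprCocycle W (q : ℤ) x)
  have hy' := galoisCohomology.res_oneCocycleClass (W.torsionGaloisModule ((q : ℕ) : ℤ)) (v.adicCompletion ℚ)
    (reprCocycle W (q : ℤ) y)
  have hcl : ∀ z : galH1Torsion W (q : ℤ),
      oneCocycleClass ((W.torsionGaloisModule ((q : ℕ) : ℤ)).toTopRep) (reprCocycle W (q : ℤ) z) = z :=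
    oneCocycleClass_reprCocycle W (q : ℤ)
  rw [hcl] at hx' hy'
  change p ^ (M - 1) • ((weilContPairing W q e hμ hadd₁ hadd₂ hgal).restrict (absGaloisRestrict ℚ (v.adicCompletion ℚ))).cupProduct
      (galoisCohomology.res (W.torsionGaloisModule ((q : ℕ) : ℤ)) (v.adicCompletion ℚ) 1 x)
      (galoisCohomology.res (W.torsionGaloisModule ((q : ℕ) : ℤ)) (v.adicCompletion ℚ) 1 y) = 0
  rw [hx', hy']
  refine nsmul_cupProduct_oneCocycleClass_eq_zero_of_nsmul_toLin_apply_eq_zero _ _ _ (p ^ (M - 1)) fun a b ↦ ?_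
  change p ^ (M - 1) • weilPairingHom W q e hμ hadd₁ hadd₂
      (h1Eval W (q : ℤ) x (resGal (K := ℚ) (v.adicCompletion ℚ) a))
      (h1Eval W (q : ℤ) y (resGal (K := ℚ) (v.adicCompletion ℚ) b)) = 0
  -- `q • μ_q = 0`, `q = p^{M-1}·p`
  have hqC : ∀ c : DiscreteGaloisModule.MuCarrier ℚ q, (p ^ (M - 1) * p) • c = 0 := fun c ↦ by
    rw [← pow_succ, Nat.sub_add_cancel hM, ← hq]
    exact nsmul_muCarrier_eq_zero q c
  exact nsmul_pairing_eq_zero_of_line_add W hF hPq hgen hfree _ (weilPairingHom_self W q e hμ hadd₁ hadd₂ halt)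
    (p ^ (M - 1)) p hqC
    (exists_h1Eval_resGal_eq_line_add_of_halfTransverse W hp hq hqv h𝔐 hFrob hFμ hF hI hopen hx a)
    (exists_h1Eval_resGal_eq_line_add_of_halfTransverse W hp hq hqv h𝔐 hFrob hFμ hF hI hopen hy b)

/-- **`loc_v (p^{M−1}·x) ∪ₑ loc_v y = 0` for two half-transverse classes** (the same statement with the multiple moved inside: the
form `⟨X_ℓ, y_ℓ⟩ = 0`, `X = 2Z`, of the LEAD's engine at `p = 2`, `M = 2`). [cite: McCallumLMS1991, §5 proof of Prop. 5.2 (p. 309)] -/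
theorem cupProduct_localization_nsmul_eq_zero_of_halfTransverse {p M q : ℕ} [NeZero q] (hp : p.Prime) (hq : q = p ^ M)
    (hM : 1 ≤ M) (hqv : (q : 𝓞 ℚ) ∉ v.asIdeal)
    {𝔐 : Ideal (HeightOneSpectrum.localAbsIntegers v)} (h𝔐 : 𝔐 ∈ v.localPrimesAbove)
    {F : absoluteGaloisGroup ℚ}
    (hFrob : IsArithFrobAt (𝓞 ℚ) F (v.primeBelow (closureEmb (K := ℚ) (v.adicCompletion ℚ)) 𝔐))
    (hFμ : ∀ ζ : AlgebraicClosure ℚ, ζ ^ q = 1 → F • ζ = ζ⁻¹)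
    (hF : ∀ Q : geomTorsion W (q : ℤ), F • F • Q = Q)
    {P : geomTorsion W (q : ℤ)} (hPq : (q : ℤ) • P = 0)
    (hgen : ∀ Q : geomTorsion W (q : ℤ), ∃ x y : ℤ, Q = x • P + y • F • P)
    (hfree : ∀ x y : ℤ, x • P + y • F • P = 0 → (q : ℤ) ∣ x ∧ (q : ℤ) ∣ y)
    (hI : (v.primeBelow (closureEmb (K := ℚ) (v.adicCompletion ℚ)) 𝔐).inertia (absoluteGaloisGroup ℚ) ≤
      torsionFixing W (q : ℤ))
    (hopen : IsOpen (torsionFixing W (q : ℤ) : Set (absoluteGaloisGroup ℚ)))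
    (e : geomTorsion W q → geomTorsion W q → AlgebraicClosure ℚ)
    (hμ : ∀ S T, e S T ^ q = 1) (hadd₁ : ∀ S₁ S₂ T, e (S₁ + S₂) T = e S₁ T * e S₂ T)
    (hadd₂ : ∀ S T₁ T₂, e S (T₁ + T₂) = e S T₁ * e S T₂) (halt : ∀ T, e T T = 1)
    (hgal : ∀ (σ : absoluteGaloisGroup ℚ) (S T : geomTorsion W q), σ • e S T = e (σ • S) (σ • T))
    {x y : galH1Torsion W (q : ℤ)}
    (hx : ∃ P₁ Q₁ : geomTorsion W (q : ℤ), h1Eval W (q : ℤ) x F = (F • P₁ - P₁) + p • Q₁)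
    (hy : ∃ P₂ Q₂ : geomTorsion W (q : ℤ), h1Eval W (q : ℤ) y F = (F • P₂ - P₂) + p • Q₂) :
    haveI := absoluteGaloisGroup_compactSpace (v.adicCompletion ℚ)
    ((weilContPairing W q e hμ hadd₁ hadd₂ hgal).restrict
      (absGaloisRestrict ℚ (v.adicCompletion ℚ))).cupProduct
        (galoisCohomology.localization (W.torsionGaloisModule ((q : ℕ) : ℤ)) (Sum.inr v) 1 ((p ^ (M - 1) : ℕ) • x))
        (galoisCohomology.localization (W.torsionGaloisModule ((q : ℕ) : ℤ)) (Sum.inr v) 1 y) = 0 := by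
  haveI := absoluteGaloisGroup_compactSpace (v.adicCompletion ℚ)
  rw [show galoisCohomology.localization (W.torsionGaloisModule ((q : ℕ) : ℤ)) (Sum.inr v) 1 ((p ^ (M - 1) : ℕ) • x) =
      (p ^ (M - 1) : ℕ) • galoisCohomology.localization (W.torsionGaloisModule ((q : ℕ) : ℤ)) (Sum.inr v) 1 x from
    map_nsmul _ _ _]
  erw [map_nsmul, LinearMap.smul_apply]
  exact nsmul_cupProduct_localization_eq_zero_of_halfTransverse W hp hq hM hqv h𝔐 hFrob hFμ hF hPq hgen hfree hI hopen e hμ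
    hadd₁ hadd₂ halt hgal hx hy

end Main

end Summit.BirchSwinnertonDyer.BirchSwinnertonDyer.Theorems.GenusExact.TransverseIsotropy

end
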